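import Mathlib.LinearAlgebra.Matrix.Determinant.Basic
import Mathlib.Analysis.SpecialFunctions.Pow.Real
import HarnessLib

/-!
# Determinants of tridiagonal matrices: the continuant recurrence and sign control

Topic `Literature/Analysis/Matrix`. For a tridiagonal matrix `M` on `Fin (m+1)` (entries vanish
when `|i - j| > 1`) the determinant satisfies the three-term **continuant recurrence**

  `det M = M₀₀ · det M[1..] - M₀₁ M₁₀ · det M[2..]`

(`det_tridiagonal_eq`, Laplace expansion along the first row and then along the first column;
Horn–Johnson 2013, §0.9.10; Muir, *Theory of Determinants*, "continuants"). Consequences over `ℝ`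
used for the linearised Galerkin systems of Kolmogorov flow (route
`AnomalousDissipation/WazewskiBlock`, tridiagonal Orr–Sommerfeld chains):

* `det_tridiagonal_pos` — **chains with positive diagonal and non-positive link products**
  `Mᵢ,ᵢ₊₁ Mᵢ₊₁,ᵢ ≤ 0` have `det M > 0`, with the two-sided continuant bounds
  `M₀₀ det M[1..] ≤ det M ≤ (M₀₀ + |M₀₁M₁₀| / M₁₁) det M[1..]`
  (`mul_det_le_det_tridiagonal`, `det_tridiagonal_le`): the skew-type coupling of advection makes
  every continuant positive (this is the determinant form of Meshalkin–Sinai's observation that the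
  chains with all `ρₙ > 0` have no neutral mode).
* `det_tridiagonal_neg_of_center` — **one destabilising pair of links**: if all link products are
  `≤ 0` except the two links adjacent to an index `c`, which are `≥ 0`, and
  `M_cc (M_{c+1,c+1} + |p_{c+1}| / M_{c+2,c+2}) < p_c` (`p_i = Mᵢ,ᵢ₊₁Mᵢ₊₁,ᵢ`), then `det M < 0`
  (the trailing continuants change sign exactly once, at `c`, and keep it). This is the sign
  certificate for an odd number of unstable eigenvalues of the `α < 1` Kolmogorov chain, uniform in
  the truncation.

No definitions; tridiagonality and the sign pattern are carried as hypotheses.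

## References

* R. A. Horn, C. R. Johnson, *Matrix Analysis*, 2nd ed. (2013), §0.9.10 (tridiagonal matrices,
  continuants). [folklore]
* L. D. Meshalkin, Ya. G. Sinai, J. Appl. Math. Mech. 25 (1961) 1700–1705 (continued fractions for
  the Kolmogorov flow).
-/

namespace Literature.Analysis.Matrix

open Finset
open _root_.Matrix

/-! ### The continuant recurrence -/

section Recurrence

variable {R : Type*} [CommRing R]

/-- **Continuant recurrence.** For a tridiagonal `(m+2) × (m+2)` matrix,
`det M = M₀₀ det M[1..] - M₀₁ M₁₀ det M[2..]` (Laplace along row `0`: only `j = 0, 1` survive;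
the `(0,1)`-minor, expanded along its first column, has the single entry `M₁₀`). [folklore] -/
theorem det_tridiagonal_eq {m : ℕ} (M : Matrix (Fin (m + 2)) (Fin (m + 2)) R)
    (htri : ∀ i j : Fin (m + 2), (i : ℕ) + 1 < j ∨ (j : ℕ) + 1 < i → M i j = 0) :
    M.det = M 0 0 * (M.submatrix Fin.succ Fin.succ).det -
      M 0 1 * M 1 0 * (M.submatrix (Fin.succ ∘ Fin.succ) (Fin.succ ∘ Fin.succ)).det := by
  rw [Matrix.det_succ_row_zero]
  -- only `j = 0` and `j = 1` contribute
  have hvan : ∀ j : Fin (m + 2), j ≠ 0 → j ≠ 1 →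
      (-1 : R) ^ (j : ℕ) * M 0 j * (M.submatrix Fin.succ j.succAbove).det = 0 := by
    intro j hj0 hj1
    have hj : (0 : ℕ) + 1 < (j : ℕ) := by
      have h0 : (j : ℕ) ≠ 0 := fun h => hj0 (Fin.ext h)
      have h1 : (j : ℕ) ≠ 1 := fun h => hj1 (Fin.ext h)
      omega
    rw [htri 0 j (Or.inl (by simpa using hj)), mul_zero, zero_mul]
  rw [Finset.sum_eq_add_of_mem (0 : Fin (m + 2)) (1 : Fin (m + 2)) (Finset.mem_univ _) (Finset.mem_univ _)
    Fin.zero_ne_one fun j _ hj => hvan j hj.1 hj.2]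
  -- the `j = 0` term
  have h0 : (-1 : R) ^ ((0 : Fin (m + 2)) : ℕ) * M 0 0 * (M.submatrix Fin.succ (0 : Fin (m + 2)).succAbove).det =
      M 0 0 * (M.submatrix Fin.succ Fin.succ).det := by
    simp [Fin.succAbove_zero]
  -- the `j = 1` term: expand the minor along its first column
  have h10 : (1 : Fin (m + 2)).succAbove 0 = 0 := Fin.succAbove_ne_zero_zero (by simp)
  have hsub' : (Fin.succAbove (1 : Fin (m + 2)) ∘ Fin.succ : Fin m → Fin (m + 2)) = Fin.succ ∘ Fin.succ := by
    funext b
    simp only [Function.comp_apply]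
    simp
  have h1 : (M.submatrix Fin.succ (1 : Fin (m + 2)).succAbove).det =
      M 1 0 * (M.submatrix (Fin.succ ∘ Fin.succ) (Fin.succ ∘ Fin.succ)).det := by
    rw [Matrix.det_succ_column_zero]
    have hvan' : ∀ i : Fin (m + 1), i ≠ 0 →
        (-1 : R) ^ (i : ℕ) * (M.submatrix Fin.succ (1 : Fin (m + 2)).succAbove) i 0 *
          ((M.submatrix Fin.succ (1 : Fin (m + 2)).succAbove).submatrix i.succAbove Fin.succ).det = 0 := by
      intro i hi
      have hentry : (M.submatrix Fin.succ (1 : Fin (m + 2)).succAbove) i 0 = 0 := by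
        rw [Matrix.submatrix_apply, h10]
        refine htri _ _ (Or.inr ?_)
        rw [Fin.val_zero, Fin.val_succ]
        have h0 : (i : ℕ) ≠ 0 := fun h => hi (Fin.ext h)
        omega
      rw [hentry, mul_zero, zero_mul]
    have hcol : (M.submatrix Fin.succ (1 : Fin (m + 2)).succAbove) 0 0 = M 1 0 := by
      simp [Matrix.submatrix_apply, h10]
    rw [Finset.sum_eq_single_of_mem (0 : Fin (m + 1)) (Finset.mem_univ _) fun i _ hi => hvan' i hi,
      Fin.val_zero, pow_zero, one_mul, hcol, Matrix.submatrix_submatrix, Fin.succAbove_zero, hsub']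
  rw [h0, h1]
  simp only [Fin.val_one, pow_one]
  ring

end Recurrence


/-! ### Transfer of the hypotheses to trailing submatrices -/

section Transfer

variable {R : Type*} [CommRing R]

/-- Tridiagonality passes to the trailing principal submatrix. [folklore] -/
theorem tridiagonal_submatrix_succ {m : ℕ} {M : Matrix (Fin (m + 1)) (Fin (m + 1)) R}
    (htri : ∀ i j : Fin (m + 1), (i : ℕ) + 1 < j ∨ (j : ℕ) + 1 < i → M i j = 0) :
    ∀ i j : Fin m, (i : ℕ) + 1 < j ∨ (j : ℕ) + 1 < i → (M.submatrix Fin.succ Fin.succ) i j = 0 := by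
  intro i j h
  rw [Matrix.submatrix_apply]
  exact htri _ _ (by simp only [Fin.val_succ]; omega)

end Transfer

/-! ### Chains with non-positive link products -/

section Real

/-- **Positivity of continuants.** A real tridiagonal matrix with positive diagonal and
non-positive link products `Mᵢ,ᵢ₊₁ Mᵢ₊₁,ᵢ ≤ 0` has positive determinant (induction on the
continuant recurrence: `det M = M₀₀ det M[1..] + |M₀₁M₁₀| det M[2..]`). [folklore] -/
theorem det_tridiagonal_pos : ∀ {n : ℕ} (M : Matrix (Fin n) (Fin n) ℝ),
    (∀ i j : Fin n, (i : ℕ) + 1 < j ∨ (j : ℕ) + 1 < i → M i j = 0) →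
    (∀ i : Fin n, 0 < M i i) →
    (∀ i j : Fin n, (j : ℕ) = i + 1 → M i j * M j i ≤ 0) → 0 < M.det := by
  intro n
  induction n using Nat.strong_induction_on with
  | _ n ih =>
    intro M htri hdiag hlink
    match n, M, htri, hdiag, hlink, ih with
    | 0, M, _, _, _, _ => simp [Matrix.det_isEmpty]
    | 1, M, _, hdiag, _, _ => rw [Matrix.det_fin_one]; exact hdiag 0
    | k + 2, M, htri, hdiag, hlink, ih =>
      rw [det_tridiagonal_eq M htri]
      have h1 : 0 < (M.submatrix Fin.succ Fin.succ).det :=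
        ih (k + 1) (by omega) _ (tridiagonal_submatrix_succ htri) (fun i => hdiag _)
          (fun i j h => hlink _ _ (by simp only [Fin.val_succ]; omega))
      have h2 : 0 < (M.submatrix (Fin.succ ∘ Fin.succ) (Fin.succ ∘ Fin.succ)).det := by
        have := ih k (by omega) ((M.submatrix Fin.succ Fin.succ).submatrix Fin.succ Fin.succ)
          (tridiagonal_submatrix_succ (tridiagonal_submatrix_succ htri)) (fun i => hdiag _)
          (fun i j h => hlink _ _ (by simp only [Fin.val_succ]; omega))
        rwa [Matrix.submatrix_submatrix] at this
      have hp : M 0 1 * M 1 0 ≤ 0 := hlink 0 1 (by simp)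
      nlinarith [mul_pos (hdiag 0) h1, mul_nonneg (neg_nonneg.2 hp) h2.le]

/-- **Lower continuant bound**: `M₀₀ det M[1..] ≤ det M` for chains as in
`det_tridiagonal_pos`. [folklore] -/
theorem mul_det_le_det_tridiagonal {k : ℕ} (M : Matrix (Fin (k + 1)) (Fin (k + 1)) ℝ)
    (htri : ∀ i j : Fin (k + 1), (i : ℕ) + 1 < j ∨ (j : ℕ) + 1 < i → M i j = 0)
    (hdiag : ∀ i : Fin (k + 1), 0 < M i i)
    (hlink : ∀ i j : Fin (k + 1), (j : ℕ) = i + 1 → M i j * M j i ≤ 0) :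
    M 0 0 * (M.submatrix Fin.succ Fin.succ).det ≤ M.det := by
  match k, M, htri, hdiag, hlink with
  | 0, M, _, _, _ => simp [Matrix.det_isEmpty]
  | j + 1, M, htri, hdiag, hlink =>
    rw [det_tridiagonal_eq M htri]
    have h2 : 0 < (M.submatrix (Fin.succ ∘ Fin.succ) (Fin.succ ∘ Fin.succ)).det := by
      have := det_tridiagonal_pos ((M.submatrix Fin.succ Fin.succ).submatrix Fin.succ Fin.succ)
        (tridiagonal_submatrix_succ (tridiagonal_submatrix_succ htri)) (fun i => hdiag _)
        (fun i j h => hlink _ _ (by simp only [Fin.val_succ]; omega))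
      rwa [Matrix.submatrix_submatrix] at this
    have hp : M 0 1 * M 1 0 ≤ 0 := hlink 0 1 (by simp)
    nlinarith [mul_nonneg (neg_nonneg.2 hp) h2.le]

/-- **Upper continuant bound**: `det M ≤ (M₀₀ + |M₀₁M₁₀| / M₁₁) det M[1..]` for chains as in
`det_tridiagonal_pos` (since `M₁₁ det M[2..] ≤ det M[1..]`). Together with the lower bound this
brackets the first convergent of the continued fraction `det M / det M[1..]` uniformly in the size.
[folklore] -/
theorem det_tridiagonal_le {k : ℕ} (M : Matrix (Fin (k + 2)) (Fin (k + 2)) ℝ)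
    (htri : ∀ i j : Fin (k + 2), (i : ℕ) + 1 < j ∨ (j : ℕ) + 1 < i → M i j = 0)
    (hdiag : ∀ i : Fin (k + 2), 0 < M i i)
    (hlink : ∀ i j : Fin (k + 2), (j : ℕ) = i + 1 → M i j * M j i ≤ 0) :
    M.det ≤ (M 0 0 + |M 0 1 * M 1 0| / M 1 1) * (M.submatrix Fin.succ Fin.succ).det := by
  rw [det_tridiagonal_eq M htri]
  have hM1 := mul_det_le_det_tridiagonal (M.submatrix Fin.succ Fin.succ) (tridiagonal_submatrix_succ htri)
    (fun i => hdiag _) (fun i j h => hlink _ _ (by simp only [Fin.val_succ]; omega))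
  rw [Matrix.submatrix_submatrix] at hM1
  have h11 : 0 < M 1 1 := hdiag 1
  have hM1' : (M.submatrix (Fin.succ ∘ Fin.succ) (Fin.succ ∘ Fin.succ)).det ≤
      (M.submatrix Fin.succ Fin.succ).det / M 1 1 := by
    rw [le_div_iff₀ h11, mul_comm]
    exact hM1
  have hp : M 0 1 * M 1 0 ≤ 0 := hlink 0 1 (by simp)
  have habs : |M 0 1 * M 1 0| = -(M 0 1 * M 1 0) := abs_of_nonpos hp
  rw [habs]
  have key : -(M 0 1 * M 1 0) * (M.submatrix (Fin.succ ∘ Fin.succ) (Fin.succ ∘ Fin.succ)).det ≤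
      -(M 0 1 * M 1 0) * ((M.submatrix Fin.succ Fin.succ).det / M 1 1) :=
    mul_le_mul_of_nonneg_left hM1' (neg_nonneg.2 hp)
  have expand : (M 0 0 + -(M 0 1 * M 1 0) / M 1 1) * (M.submatrix Fin.succ Fin.succ).det =
      M 0 0 * (M.submatrix Fin.succ Fin.succ).det +
        -(M 0 1 * M 1 0) * ((M.submatrix Fin.succ Fin.succ).det / M 1 1) := by ring
  rw [expand]
  linarith

/-! ### One destabilising pair of links: the sign certificate -/

/-- **Negative determinant from one destabilising pair of links.** Let `M` be a real tridiagonal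
`n × n` matrix with positive diagonal, and `c` an index with `c + 3 ≤ n`. Suppose every link product
`Mᵢ,ᵢ₊₁Mᵢ₊₁,ᵢ` is `≤ 0` except for the two links adjacent to `c` (`i + 1 = c` and `i = c`), that the
link `(c-1, c)` (if any) has product `≥ 0`, and that
`M_cc · (M_{c+1,c+1} + |p_{c+1}| / M_{c+2,c+2}) < p_c`, `pᵢ = Mᵢ,ᵢ₊₁Mᵢ₊₁,ᵢ`. Then `det M < 0`:
the trailing continuants are positive below `c` (`det_tridiagonal_pos`), the one starting at `c`
is negative by the upper continuant bound, and the sign then propagates to the top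
(`det = t·(neg) - p·(pos)` with `p ≥ 0` across the link `(c-1,c)`, `det = t·(neg) + |p|·(neg)` above).
This is the truncation-uniform certificate for an odd unstable count of the Meshalkin–Sinai chain
with `α < 1`. [folklore] -/
theorem det_tridiagonal_neg_of_center : ∀ (c : ℕ) {n : ℕ} (M : Matrix (Fin n) (Fin n) ℝ) (hc : c + 3 ≤ n),
    (∀ i j : Fin n, (i : ℕ) + 1 < j ∨ (j : ℕ) + 1 < i → M i j = 0) →
    (∀ i : Fin n, 0 < M i i) →
    (∀ i j : Fin n, (j : ℕ) = i + 1 → (i : ℕ) + 1 ≠ c → (i : ℕ) ≠ c → M i j * M j i ≤ 0) →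
    (∀ i j : Fin n, (j : ℕ) = i + 1 → (i : ℕ) + 1 = c → 0 ≤ M i j * M j i) →
    M ⟨c, by omega⟩ ⟨c, by omega⟩ *
        (M ⟨c + 1, by omega⟩ ⟨c + 1, by omega⟩ +
          |M ⟨c + 1, by omega⟩ ⟨c + 2, by omega⟩ * M ⟨c + 2, by omega⟩ ⟨c + 1, by omega⟩| /
            M ⟨c + 2, by omega⟩ ⟨c + 2, by omega⟩) <
      M ⟨c, by omega⟩ ⟨c + 1, by omega⟩ * M ⟨c + 1, by omega⟩ ⟨c, by omega⟩ →
    M.det < 0 := by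
  intro c
  induction c using Nat.strong_induction_on with
  | _ c ih =>
    intro n M hc htri hdiag hlink hposL hcrit
    obtain ⟨k, rfl⟩ : ∃ k, n = k + 2 := ⟨n - 2, by omega⟩
    rw [det_tridiagonal_eq M htri]
    rcases Nat.eq_zero_or_pos c with rfl | hcpos
    · -- base: the centre is the first index
      have hM1tri := tridiagonal_submatrix_succ htri
      have hM1link : ∀ i j : Fin (k + 1), (j : ℕ) = i + 1 →
          (M.submatrix Fin.succ Fin.succ) i j * (M.submatrix Fin.succ Fin.succ) j i ≤ 0 :=
        fun i j h => hlink _ _ (by simp only [Fin.val_succ]; omega) (by simp) (by simp)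
      obtain ⟨k', rfl⟩ : ∃ k', k = k' + 1 := ⟨k - 1, by omega⟩
      have hup := det_tridiagonal_le (M.submatrix Fin.succ Fin.succ) hM1tri (fun i => hdiag _) hM1link
      rw [Matrix.submatrix_submatrix] at hup
      have h2 : 0 < (M.submatrix (Fin.succ ∘ Fin.succ) (Fin.succ ∘ Fin.succ)).det := by
        have := det_tridiagonal_pos ((M.submatrix Fin.succ Fin.succ).submatrix Fin.succ Fin.succ)
          (tridiagonal_submatrix_succ hM1tri) (fun i => hdiag _)
          (fun i j h => hM1link _ _ (by simp only [Fin.val_succ]; omega))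
        rwa [Matrix.submatrix_submatrix] at this
      -- read the criterion in the entries of `M`
      have hcrit' : M 0 0 * (M 1 1 + |M 1 2 * M 2 1| / M 2 2) < M 0 1 * M 1 0 := by
        convert hcrit using 3 <;> rfl
      have hsub11 : (M.submatrix Fin.succ Fin.succ) 0 0 = M 1 1 := rfl
      have hsub12 : (M.submatrix Fin.succ Fin.succ) 0 1 * (M.submatrix Fin.succ Fin.succ) 1 0 = M 1 2 * M 2 1 := rfl
      have hsub22 : (M.submatrix Fin.succ Fin.succ) 1 1 = M 2 2 := rfl
      rw [hsub11, hsub12, hsub22] at hup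
      have h00 := hdiag 0
      have hA : M 0 0 * (M.submatrix Fin.succ Fin.succ).det ≤
          M 0 0 * ((M 1 1 + |M 1 2 * M 2 1| / M 2 2) * (M.submatrix (Fin.succ ∘ Fin.succ) (Fin.succ ∘ Fin.succ)).det) :=
        mul_le_mul_of_nonneg_left hup h00.le
      nlinarith [mul_lt_mul_of_pos_right hcrit' h2]
    · -- step: peel the first row
      have hc1 : (c - 1) + 3 ≤ k + 1 := by omega
      have hM1tri := tridiagonal_submatrix_succ htri
      have hD1 : (M.submatrix Fin.succ Fin.succ).det < 0 := by
        refine ih (c - 1) (by omega) (M.submatrix Fin.succ Fin.succ) hc1 hM1tri (fun i => hdiag _)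
          (fun i j h h1 h2 => hlink _ _ (by simp only [Fin.val_succ]; omega) (by simp only [Fin.val_succ]; omega)
            (by simp only [Fin.val_succ]; omega))
          (fun i j h h1 => hposL _ _ (by simp only [Fin.val_succ]; omega) (by simp only [Fin.val_succ]; omega)) ?_
        have e0 : (⟨c - 1, by omega⟩ : Fin (k + 1)).succ = ⟨c, by omega⟩ := Fin.ext (by simp; omega)
        have e1 : (⟨c - 1 + 1, by omega⟩ : Fin (k + 1)).succ = ⟨c + 1, by omega⟩ := Fin.ext (by simp; omega)
        have e2 : (⟨c - 1 + 2, by omega⟩ : Fin (k + 1)).succ = ⟨c + 2, by omega⟩ := Fin.ext (by simp; omega)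
        simp only [Matrix.submatrix_apply, e0, e1, e2]
        exact hcrit
      have h00 := hdiag 0
      rcases Nat.eq_zero_or_pos (c - 1) with hc01 | hc2
      · -- `c = 1`: the peeled link is the destabilising link `(c-1, c)`, of product `≥ 0`
        have hc1' : c = 1 := by omega
        have hp : 0 ≤ M 0 1 * M 1 0 := hposL 0 1 (by simp) (by simp [hc1'])
        have h2 : 0 < (M.submatrix (Fin.succ ∘ Fin.succ) (Fin.succ ∘ Fin.succ)).det := by
          obtain ⟨k', rfl⟩ : ∃ k', k = k' + 1 := ⟨k - 1, by omega⟩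
          have := det_tridiagonal_pos ((M.submatrix Fin.succ Fin.succ).submatrix Fin.succ Fin.succ)
            (tridiagonal_submatrix_succ hM1tri) (fun i => hdiag _)
            (fun i j h => hlink _ _ (by simp only [Fin.val_succ]; omega)
              (by simp only [Fin.val_succ]; omega) (by simp only [Fin.val_succ]; omega))
          rwa [Matrix.submatrix_submatrix] at this
        nlinarith [mul_neg_of_pos_of_neg h00 hD1, mul_nonneg hp h2.le]
      · -- `c ≥ 2`: the peeled link is an ordinary one
        have hp : M 0 1 * M 1 0 ≤ 0 := hlink 0 1 (by simp) (by simp; omega) (by simp; omega)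
        have hD2 : (M.submatrix (Fin.succ ∘ Fin.succ) (Fin.succ ∘ Fin.succ)).det < 0 := by
          have hc2' : (c - 2) + 3 ≤ k := by omega
          have := ih (c - 2) (by omega) ((M.submatrix Fin.succ Fin.succ).submatrix Fin.succ Fin.succ) hc2'
            (tridiagonal_submatrix_succ hM1tri) (fun i => hdiag _)
            (fun i j h h1 h2 => hlink _ _ (by simp only [Fin.val_succ]; omega)
              (by simp only [Fin.val_succ]; omega) (by simp only [Fin.val_succ]; omega))
            (fun i j h h1 => hposL _ _ (by simp only [Fin.val_succ]; omega)
              (by simp only [Fin.val_succ]; omega)) ?_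
          · rwa [Matrix.submatrix_submatrix] at this
          · have e0 : ((⟨c - 2, by omega⟩ : Fin k).succ).succ = (⟨c, by omega⟩ : Fin (k + 2)) := Fin.ext (by simp; omega)
            have e1 : ((⟨c - 2 + 1, by omega⟩ : Fin k).succ).succ = (⟨c + 1, by omega⟩ : Fin (k + 2)) :=
              Fin.ext (by simp; omega)
            have e2 : ((⟨c - 2 + 2, by omega⟩ : Fin k).succ).succ = (⟨c + 2, by omega⟩ : Fin (k + 2)) :=
              Fin.ext (by simp; omega)
            simp only [Matrix.submatrix_apply, e0, e1, e2]
            exact hcrit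
        nlinarith [mul_neg_of_pos_of_neg h00 hD1, mul_nonneg (neg_nonneg.2 hp) (neg_nonneg.2 hD2.le)]

end Real

end Literature.Analysis.Matrix
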